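import Literature.Computability.Cryptography.RegevBDDToLWESamples
import Literature.Computability.Cryptography.RegevVerificationTest
import HarnessLib

/-!
# Regev 2009, Lemma 3.11 at a finer rounding scale: the manufactured sample `(L⁻¹v mod p, ⌊pK·y⌉ mod pK)` is close to the fine `LWE` law `A^{(K)}_{s,Ψ̄_β}`

Topic `Computability/Cryptography` (family `pqc`), grouping namespace `Regev2009`; sequel of
`RegevBDDToLWESample.lean` (Lemma 3.11 for the coarse sample `(a, ⌊p·y⌉ mod p)`, `Δ ≤ 6ε`) and
`RegevBDDToLWESamples.lean` (approximate sampler, `N` samples), companion of `RegevVerificationTest.lean`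
(the fine `LWE` law `lweSampleK`, the embedding `kmul`, Regev's verification test of Lemma 3.6).
Everything here is PROVED (theorems and one definition WITH BODY); no named fact.

In Regev's classical reduction (Lemma 3.4 = Peikert 2009, Prop. 3.2; hypothesis `h₂` of
`peikert_gapSVPZeta_to_lwe_classical_of_components`, pqc.S20) the reduction manufactures, from the `BDD`
target `x` and a lattice sample `v`, the real number `y = ⟨x, v⟩/p + e` (Lemma 3.11, Eq. (10)); the `LWE`
oracle is fed `⌊p·y⌉ mod p`, but the VERIFICATION of a returned candidate (Lemma 3.6) is a statistical
test on `y` itself. A machine holding `y` as an exact rational rounds it at the finer scale `1/(pK)`: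
this file proves that the fine sample `(L⁻¹v mod p, ⌊pK·y⌉ mod pK)` is within `6ε` (exact `v ← D_{L,r}`),
resp. `δ + 6ε` (a `δ`-approximate sampler), of the fine `LWE` law `A^{(K)}_{s,Ψ̄^{(pK)}_β}`
(`lweSampleK p K (LWE.discretizedGaussian (p*K) β) s`: `a` uniform, `b = kmul⟨a,s⟩ + ⌊pK·e'⌉`,
`e' ∼ N(0, β²/(2π))`), with the same `s = (L*)⁻¹κ mod p` and `β = √((r‖x-κ‖/p)² + α₀²)` as the coarse
sample — so that the error bounds of `RegevVerificationTest.lean` apply to the reduction's own samples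
up to `N(δ + 6ε)`.

## Results

* `discretize_mul_intCast_div_add`, `discretize_mul_inner_div_add` — **integrality at scale `K`**:
  `⌊pK(k/p + w)⌉ = K·k + ⌊pK·w⌉`, hence `⌊pK(⟨x,v⟩/p + e)⌉ mod pK = kmul⟨L⁻¹v mod p, s⟩ + ⌊pK(⟨x'/p, v⟩ + e)⌉`
  (`x' = x - κ`, `κ ∈ L*`; the coarse case `K = 1` is `discretize_inner_div_add`).
* `bddLWESampleFineOf b p K D x α₀` — the fine sample map on a source `D` of lattice vectors.
* `tvDist_noise_fibre_fine_le` (`4ε` per class, Cor. 3.10 on the coset `pL + La`),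
  `tvDist_bddLWESampleFine_lweSampleK_le` (**`Δ ≤ 6ε`**, exact sampler),
  `tvDist_bddLWESampleFineOf_lweSampleK_le` (`δ + 6ε`), `tvDist_iidPMF_bddLWESampleFineOf_le` (`N` samples,
  `N(δ + 6ε)`) — proofs verbatim those of the coarse case with `⌊p·⌉` replaced by `⌊pK·⌉`.

## References

* O. Regev, *On lattices, learning with errors, random linear codes, and cryptography*, J. ACM 56
  (2009), art. 34 = arXiv:2401.03703, Lemma 3.11 (proof, Eq. (10)), Lemma 3.6, Corollary 3.10
  [RegevLWE2009].
* C. Peikert, *Public-key cryptosystems from the worst-case shortest vector problem*, STOC 2009,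
  Prop. 3.2 [Peikert2009].
-/

noncomputable section

open MeasureTheory ProbabilityTheory Module Literature.Algebra.EuclideanLattices
open scoped Real ENNReal InnerProductSpace NNReal

namespace Literature.Computability.Cryptography

namespace Regev2009

/-! ### Integrality at scale `K` -/

section Integrality

variable {E : Type*} [NormedAddCommGroup E] [InnerProductSpace ℝ E]
variable {L : Submodule ℤ E}
variable {ι : Type} [Fintype ι] (b : Basis ι ℤ L) (p K : ℕ) [NeZero p]

/-- `⌊pK(k/p + w)⌉ = K·k + ⌊pK·w⌉`, i.e. `discretize (p*K) (k/p + w) = kmul k + discretize (p*K) w`.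
[folklore] -/
theorem discretize_mul_intCast_div_add (k : ℤ) (w : ℝ) :
    LWE.discretize (p * K) ((k : ℝ) / p + w) = kmul p K (k : ZMod p) + LWE.discretize (p * K) w := by
  have hp : (p : ℝ) ≠ 0 := NeZero.ne (p : ℝ)
  unfold LWE.discretize
  rw [kmul_intCast]
  have h : ((p * K : ℕ) : ℝ) * ((k : ℝ) / p + w) = (((K : ℤ) * k : ℤ) : ℝ) + ((p * K : ℕ) : ℝ) * w := by
    push_cast
    field_simp
  rw [h, round_intCast_add, Int.cast_add]

/-- **Splitting the fine second component**: for `κ ∈ L*` and `v ∈ L`,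
`⌊pK(⟨x, v⟩/p + e)⌉ mod pK = kmul⟨L⁻¹v mod p, s⟩ + ⌊pK(⟨x'/p, v⟩ + e)⌉ mod pK`, `x' = x - κ`,
`s = (L*)⁻¹κ mod p` (Regev: "`⟨x, v⟩/p + e = ⟨x'/p, v⟩ + e + ⟨κ, v⟩/p`", `⟨κ, v⟩ ≡ ⟨a, s⟩ (mod p)`).
[cite: RegevLWE2009, Lemma 3.11 (proof)] -/
theorem discretize_mul_inner_div_add {x κ : E} (hκ : κ ∈ dualLattice L) (v : L) (e : ℝ) :
    LWE.discretize (p * K) (⟪x, (v : E)⟫_ℝ / p + e) =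
      kmul p K (coeffMod b p v ⬝ᵥ secretOf b p κ) +
        LWE.discretize (p * K) (⟪(p : ℝ)⁻¹ • (x - κ), (v : E)⟫_ℝ + e) := by
  have hp : (p : ℝ) ≠ 0 := NeZero.ne (p : ℝ)
  have hsplit : ⟪x, (v : E)⟫_ℝ / p + e =
      ((∑ i, b.repr v i * round (⟪κ, ((b i : L) : E)⟫_ℝ) : ℤ) : ℝ) / p +
        (⟪(p : ℝ)⁻¹ • (x - κ), (v : E)⟫_ℝ + e) := by
    rw [← inner_coe_eq_intCast_sum b hκ v, real_inner_smul_left, inner_sub_left]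
    field_simp
    ring
  rw [hsplit, discretize_mul_intCast_div_add, intCast_sum_eq_dotProduct]

end Integrality

/-! ### The fine manufactured sample -/

section Sample

variable {E : Type*} [NormedAddCommGroup E] [InnerProductSpace ℝ E] [FiniteDimensional ℝ E]
  [MeasurableSpace E] [BorelSpace E]
variable {L : Submodule ℤ E} [DiscreteTopology L] [IsZLattice ℝ L]
variable {ι : Type} [Fintype ι] [DecidableEq ι] (b : Basis ι ℤ L) (p K : ℕ) [NeZero p] [NeZero K]

/-- LOCAL GLUE. The FINE manufactured sample of Lemma 3.11 on a source `D` of lattice vectors: `v ← D`,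
`e ∼ N(0, α₀²/(2π))`, output `(L⁻¹v mod p, ⌊pK(⟨x, v⟩/p + e)⌉ mod pK)` — the same real number
`y = ⟨x, v⟩/p + e` as the coarse sample `bddLWESampleOf` (Eq. (10)), rounded at scale `1/(pK)` for the
verification test. [cite: RegevLWE2009, Lemma 3.11 (proof, Eq. (10)) with Lemma 3.6] -/
def bddLWESampleFineOf (D : PMF L) (x : E) (α₀ : ℝ) : PMF ((ι → ZMod p) × ZMod (p * K)) :=
  D.bind fun v => (noiseZMod (p * K) α₀ (⟪x, (v : E)⟫_ℝ / p)).map fun k => (coeffMod b p v, k)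

omit [DecidableEq ι] in
/-- **The conditional law of the fine noise, per class `a`**: for `v = y + w`, `y ← D_{pL,r,-w}` (class
`a = L⁻¹w mod p`) and `e ∼ N(0, α₀²/(2π))`, the law of `⌊pK(⟨x, v⟩/p + e)⌉ mod pK` is within `4ε` of
`kmul⟨a, s⟩ + Ψ̄^{(pK)}_β`, `β = √((r‖x-κ‖/p)² + α₀²)`, provided `√2·p·η_ε(L) ≤ r`, `r‖x-κ‖ ≤ α₀p`
(`κ ∈ L*`) — Corollary 3.10 on the coset, exactly as in the coarse case `tvDist_noise_fibre_le`.
[cite: RegevLWE2009, Lemma 3.11 (proof) with Corollary 3.10] -/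
theorem tvDist_noise_fibre_fine_le {ε r α₀ : ℝ} (hε : 0 < ε) (hε' : ε ≤ 1 / 2) (hr : 0 < r)
    (hα : 0 < α₀) (hη : Real.sqrt 2 * p * smoothingParameter L ε ≤ r) {x κ : E}
    (hκ : κ ∈ dualLattice L) (hx : r * ‖x - κ‖ ≤ α₀ * p) (a : ι → ZMod p) (w : L)
    (hw : coeffMod b p w = a) :
    (((discreteGaussian (smulLattice b p) r (-(w : E))).bind fun y =>
        noiseZMod (p * K) α₀ (⟪x, (y : E) + w⟫_ℝ / p)).tvDist
      ((LWE.discretizedGaussian (p * K) (Real.sqrt ((r * ‖x - κ‖ / p) ^ 2 + α₀ ^ 2))).map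
        fun k => kmul p K (a ⬝ᵥ secretOf b p κ) + k)) ≤ 4 * ε := by
  classical
  set L₀ := smulLattice b p with hL₀
  set z : E := (p : ℝ)⁻¹ • (x - κ) with hz
  set s := secretOf b p κ with hs
  set β : ℝ := Real.sqrt ((r * ‖x - κ‖ / p) ^ 2 + α₀ ^ 2) with hβ
  refine PMF.tvDist_le_of_forall_toOuterMeasure_sub_le _ _ fun S => ?_
  set B : Set ℝ := (fun t : ℝ => kmul p K (a ⬝ᵥ s) + LWE.discretize (p * K) t) ⁻¹' S with hB
  have hBm : MeasurableSet B :=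
    ((LWE.measurable_discretize (p * K)).const_add (kmul p K (a ⬝ᵥ s))) S.to_countable.measurableSet
  -- the event on the left, as sampled: a sum over the coset
  have hleft : ((((discreteGaussian L₀ r (-(w : E))).bind fun y =>
        noiseZMod (p * K) α₀ (⟪x, (y : E) + w⟫_ℝ / p)).toOuterMeasure S).toReal) =
      ∑' y : L₀, (discreteGaussian L₀ r (-(w : E)) y).toReal *
        (gaussianReal 0 (Real.toNNReal (α₀ ^ 2 / (2 * π)))).real
          ((fun e : ℝ => ⟪z, (y : E) + w⟫_ℝ + e) ⁻¹' B) := by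
    rw [PMF.toReal_toOuterMeasure_bind_apply]
    refine tsum_congr fun y => ?_
    rw [toReal_toOuterMeasure_noiseZMod]
    congr 2
    ext e
    set v : L := ⟨(y : E), smulLattice_le b p y.2⟩ + w with hv
    have hvE : (y : E) + w = (v : E) := rfl
    have hφv : coeffMod b p v = a := by
      rw [hv, map_add, hw, (coeffMod_eq_zero_iff b p _).2 y.2, zero_add]
    simp only [Set.mem_preimage, hB]
    rw [hvE, discretize_mul_inner_div_add b p K hκ v e, hφv]
  -- the event on the right
  have hright : ((((LWE.discretizedGaussian (p * K) β).map fun k => kmul p K (a ⬝ᵥ s) + k).toOuterMeasure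
      S).toReal) = (gaussianReal 0 (Real.toNNReal (β ^ 2 / (2 * π)))).real B := by
    rw [PMF.toOuterMeasure_map_apply, ← noiseZMod_zero, toReal_toOuterMeasure_noiseZMod]
    congr 1
    ext e
    simp only [Set.mem_preimage, hB, zero_add]
  rw [hleft, hright]
  have hzβ : ‖z‖ ^ 2 * r ^ 2 + α₀ ^ 2 = β ^ 2 := by
    rw [hβ, Real.sq_sqrt (by positivity), hz, norm_smul, norm_inv, Real.norm_natCast]
    field_simp
  have hcor := Regev2009.corollary_3_10 L₀ (w : E) z hε hε' hr hα
    (smoothingParameter_smulLattice_le_one_div_sqrt b p hε hr hα hη hx) hBm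
  rw [hzβ] at hcor
  exact (le_abs_self _).trans hcor

omit [MeasurableSpace E] [BorelSpace E] [DecidableEq ι] in
/-- The fine sample map, disintegrated along `a = L⁻¹v mod p` (as `bddLWESample_eq_bind`). [cite: RegevLWE2009, Lemma 3.11 (proof)] -/
theorem bddLWESampleFine_eq_bind (rep : (ι → ZMod p) → L) (hrep : ∀ a, coeffMod b p (rep a) = a)
    (x : E) {r : ℝ} (hr : 0 < r) (α₀ : ℝ) :
    bddLWESampleFineOf b p K (discreteGaussian L r 0) x α₀ =
      ((discreteGaussian L r 0).map (coeffMod b p)).bind fun a =>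
        (((discreteGaussian (smulLattice b p) r (-(rep a : E))).bind fun y =>
          noiseZMod (p * K) α₀ (⟪x, (y : E) + rep a⟫_ℝ / p)).map (Prod.mk a)) := by
  have hker : ∀ v : L, coeffMod b p v = 0 ↔ (v : E) ∈ smulLattice b p := coeffMod_eq_zero_iff b p
  unfold bddLWESampleFineOf
  conv_lhs => rw [discreteGaussian_eq_bind_fibre (smulLattice_le b p) (coeffMod b p) hker rep hrep hr 0]
  rw [PMF.bind_bind]
  refine congrArg _ (funext fun a => ?_)
  rw [PMF.bind_map, PMF.map_bind, zero_sub]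
  refine congrArg _ (funext fun y => ?_)
  simp only [Function.comp_apply]
  have hφ : coeffMod b p ⟨(y : E) + rep a, add_mem (smulLattice_le b p y.2) (rep a).2⟩ = a := by
    have h : (⟨(y : E) + rep a, add_mem (smulLattice_le b p y.2) (rep a).2⟩ : L) =
        ⟨(y : E), smulLattice_le b p y.2⟩ + rep a := rfl
    rw [h, map_add, hrep, (hker _).2 y.2, zero_add]
  rw [hφ]

omit [Fintype ι] [DecidableEq ι] [NeZero p] [NeZero K] in
/-- `A^{(K)}_{s,χ}` disintegrated along `a`. [folklore] -/
theorem lweSampleK_eq_bind [Fintype ι] [DecidableEq ι] [NeZero p] [NeZero K] (χ : PMF (ZMod (p * K)))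
    (s : ι → ZMod p) :
    lweSampleK p K χ s = (PMF.uniformOfFintype (ι → ZMod p)).bind fun a =>
      (χ.map fun k => kmul p K (a ⬝ᵥ s) + k).map (Prod.mk a) := by
  unfold lweSampleK
  refine congrArg _ (funext fun a => ?_)
  rw [PMF.map_comp]
  rfl

/-- **Regev 2009, Lemma 3.11 at scale `1/(pK)`.** Under the hypotheses of the coarse statement
(`0 < ε ≤ 1/2`, `√2·p·η_ε(L) ≤ r`, `0 < α₀`, `κ ∈ L*`, `r‖x - κ‖ ≤ α₀p`), the law of the fine sample
`(L⁻¹v mod p, ⌊pK(⟨x, v⟩/p + e)⌉ mod pK)` for `v ← D_{L,r}`, `e ∼ N(0, α₀²/(2π))` is within statistical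
distance `6ε` of the fine `LWE` law `A^{(K)}_{s,Ψ̄^{(pK)}_β}`, `s = (L*)⁻¹κ mod p`,
`β = √((r‖x - κ‖/p)² + α₀²)`: `2ε` for the near-uniformity of `a` (GPV smoothing over `pL`) plus `4ε`
for the noise (Cor. 3.10 per coset). [cite: RegevLWE2009, Lemma 3.11 (proof), with Claim 3.8 and Corollary 3.10] -/
theorem tvDist_bddLWESampleFine_lweSampleK_le {ε r α₀ : ℝ} (hε : 0 < ε) (hε' : ε ≤ 1 / 2) (hr : 0 < r)
    (hα : 0 < α₀) (hη : Real.sqrt 2 * p * smoothingParameter L ε ≤ r) {x κ : E}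
    (hκ : κ ∈ dualLattice L) (hx : r * ‖x - κ‖ ≤ α₀ * p) :
    (bddLWESampleFineOf b p K (discreteGaussian L r 0) x α₀).tvDist
      (lweSampleK p K (LWE.discretizedGaussian (p * K) (Real.sqrt ((r * ‖x - κ‖ / p) ^ 2 + α₀ ^ 2)))
        (secretOf b p κ)) ≤ 6 * ε := by
  classical
  obtain ⟨rep, hrep⟩ : ∃ rep : (ι → ZMod p) → L, ∀ a, coeffMod b p (rep a) = a :=
    ⟨fun a => (coeffMod_surjective b p a).choose, fun a => (coeffMod_surjective b p a).choose_spec⟩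
  have hker : ∀ v : L, coeffMod b p v = 0 ↔ (v : E) ∈ smulLattice b p := coeffMod_eq_zero_iff b p
  set β : ℝ := Real.sqrt ((r * ‖x - κ‖ / p) ^ 2 + α₀ ^ 2) with hβ
  set s := secretOf b p κ with hs
  set P : PMF (ι → ZMod p) := (discreteGaussian L r 0).map (coeffMod b p) with hP
  set U : PMF (ι → ZMod p) := PMF.uniformOfFintype (ι → ZMod p) with hU
  set F : (ι → ZMod p) → PMF ((ι → ZMod p) × ZMod (p * K)) := fun a =>
    (((discreteGaussian (smulLattice b p) r (-(rep a : E))).bind fun y =>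
      noiseZMod (p * K) α₀ (⟪x, (y : E) + rep a⟫_ℝ / p)).map (Prod.mk a)) with hF
  set G : (ι → ZMod p) → PMF ((ι → ZMod p) × ZMod (p * K)) := fun a =>
    ((LWE.discretizedGaussian (p * K) β).map fun k => kmul p K (a ⬝ᵥ s) + k).map (Prod.mk a) with hG
  have h0 : bddLWESampleFineOf b p K (discreteGaussian L r 0) x α₀ = P.bind F :=
    bddLWESampleFine_eq_bind b p K rep hrep x hr α₀
  have hT : lweSampleK p K (LWE.discretizedGaussian (p * K) β) s = U.bind G := lweSampleK_eq_bind p K _ s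
  have hηr : smoothingParameter (smulLattice b p) ε ≤ r := by
    refine (smoothingParameter_smulLattice_le b p hε).trans ?_
    have h2 : 1 ≤ Real.sqrt 2 := Real.one_le_sqrt.2 (by norm_num)
    have hη0 : 0 ≤ (p : ℝ) * smoothingParameter L ε :=
      mul_nonneg (Nat.cast_nonneg _) (smoothingParameter_nonneg L ε)
    nlinarith
  have h1 : (P.bind F).tvDist (U.bind F) ≤ 2 * ε :=
    (PMF.tvDist_bind_left_le P U F).trans
      (tvDist_map_discreteGaussian_uniformOfFintype_le_two_mul (smulLattice_le b p) (coeffMod b p)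
        (coeffMod_surjective b p) hker hε hr hηr 0)
  have h2 : (U.bind F).tvDist (U.bind G) ≤ 4 * ε := by
    refine PMF.tvDist_bind_le_of_forall_le U F G fun a => ?_
    refine (PMF.tvDist_map_le_holds (Prod.mk a) _ _).trans ?_
    exact tvDist_noise_fibre_fine_le b p K hε hε' hr hα hη hκ hx a (rep a) (hrep a)
  rw [h0, hT]
  calc (P.bind F).tvDist (U.bind G)
      ≤ (P.bind F).tvDist (U.bind F) + (U.bind F).tvDist (U.bind G) := PMF.tvDist_triangle_holds _ _ _
    _ ≤ 2 * ε + 4 * ε := add_le_add h1 h2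
    _ = 6 * ε := by ring

/-- **With an approximate sampler**: if `Δ(D, D_{L,r}) ≤ δ` then the fine manufactured sample is within
`δ + 6ε` of `A^{(K)}_{s,Ψ̄^{(pK)}_β}`. [cite: RegevLWE2009, Lemma 3.11 (proof); Peikert2009, Prop. 3.2 with Prop. 2.8] -/
theorem tvDist_bddLWESampleFineOf_lweSampleK_le (D : PMF L) {δ ε r α₀ : ℝ}
    (hD : D.tvDist (discreteGaussian L r 0) ≤ δ) (hε : 0 < ε) (hε' : ε ≤ 1 / 2) (hr : 0 < r)
    (hα : 0 < α₀) (hη : Real.sqrt 2 * p * smoothingParameter L ε ≤ r) {x κ : E}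
    (hκ : κ ∈ dualLattice L) (hx : r * ‖x - κ‖ ≤ α₀ * p) :
    (bddLWESampleFineOf b p K D x α₀).tvDist
      (lweSampleK p K (LWE.discretizedGaussian (p * K) (Real.sqrt ((r * ‖x - κ‖ / p) ^ 2 + α₀ ^ 2)))
        (secretOf b p κ)) ≤ δ + 6 * ε := by
  refine (PMF.tvDist_triangle_holds _ (bddLWESampleFineOf b p K (discreteGaussian L r 0) x α₀) _).trans
    (add_le_add ?_ ?_)
  · exact (PMF.tvDist_bind_left_le _ _ _).trans hD
  · exact tvDist_bddLWESampleFine_lweSampleK_le b p K hε hε' hr hα hη hκ hx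

/-- **`N` independent fine samples** are within `N(δ + 6ε)` of `N` genuine fine samples (hybrid bound
`LWE.tvDist_iidPMF_le`) — the batch fed to the verification test of `RegevVerificationTest.lean`.
[cite: RegevLWE2009, Lemma 3.11 (proof: "by running this procedure a polynomial number of times")] -/
theorem tvDist_iidPMF_bddLWESampleFineOf_le (D : PMF L) {δ ε r α₀ : ℝ}
    (hD : D.tvDist (discreteGaussian L r 0) ≤ δ) (hε : 0 < ε) (hε' : ε ≤ 1 / 2) (hr : 0 < r)
    (hα : 0 < α₀) (hη : Real.sqrt 2 * p * smoothingParameter L ε ≤ r) {x κ : E}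
    (hκ : κ ∈ dualLattice L) (hx : r * ‖x - κ‖ ≤ α₀ * p) (N : ℕ) :
    (LWE.iidPMF (bddLWESampleFineOf b p K D x α₀) N).tvDist
      (LWE.iidPMF (lweSampleK p K (LWE.discretizedGaussian (p * K)
        (Real.sqrt ((r * ‖x - κ‖ / p) ^ 2 + α₀ ^ 2))) (secretOf b p κ)) N) ≤ N * (δ + 6 * ε) := by
  refine (LWE.tvDist_iidPMF_le _ _ N).trans ?_
  exact mul_le_mul_of_nonneg_left
    (tvDist_bddLWESampleFineOf_lweSampleK_le b p K D hD hε hε' hr hα hη hκ hx) (Nat.cast_nonneg N)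

end Sample

end Regev2009

end Literature.Computability.Cryptography
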